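import Summits.Ventures.Crystal3D.Theorems.StickyWulffConstantTextureBuildPieceWindow
import Summits.Ventures.Crystal3D.Theorems.StickyWulffConstantTextureBuildHealCollar
import HarnessLib

/-!
# TB-1 brick: PLATES BY SURGERY, ALL GRAINS AT ONCE — one healed packing occupying every chosen plate slab, with the ε-bill `12·Σ #Dfx / m` and the count
# (lane T, crux `TextureLiminfV5`, stmt-Ventures-23912; memo HOME/wulff-p2/g25/SLAB-PLATES-g25.md §3 (steps 1–3, 5), §9, §10)

HONEST FRAMING. Venture `Summits/Ventures/Crystal3D` (cell `crystal3d-full`), route `route-Ventures-StickyWulffConstant`, helper `--supports` the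
law-v5 crux `TextureLiminfV5` (stmt-Ventures-23912).  Composition (census-free, standard axioms) of `exists_piece_window` ('…PieceWindow') with
`exists_site_heal_family_collar` ('…HealCollar').  No cover is built; F-C1 not moved.

WHY.  §3 of the memo as ONE call.  For every grain `f` (finitely many; stackings `S_f`), its cells `c ∈ cells f` come with the column site sets `P f c ⊆ S_f`,
their `1`-Lipschitz heights `φ f c`, bases `a₀ f c` and finite defect sets `Dfx f c ⊇` {vacant `S_f`-sites, off-`S_f` balls within `< 3` of `P f c`}; columns of
different grains are `> 4` apart.  Then for a common thickness `t` and `m ≥ 1` candidate slabs there are ONE healed unit packing `x'`, one slab index `k f < m`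
per grain, and windows `W f` = the union of the cells' chosen slabs, such that every site of every window is a ball of `x'`,
`6N' − b(x') ≤ 6N − b(x) + 12·(Σ_f Σ_c #Dfx f c)/m`, and `N ≤ N' + 27·Σ_f #W f`.

* **`exists_plates_heal`** — the statement above (the `range x'` description of `exists_site_heal_family` is passed through).
-/

noncomputable section

namespace Summit.Ventures.Crystal3D.Theorems

open Finset Summit.Ventures.Crystal3D
open Literature.MathematicalPhysics.StatisticalMechanics (IsHaggSeq)
open Summit.Ventures.Crystal3D.Cruxes.TextureLiminf.TexShadow (E3 stacking)

variable {N : ℕ} {x : Fin N → E3} {ι : Type*} [Fintype ι] {κ : Type*}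
  {L : ι → (E3 ≃ₗᵢ[ℝ] E3)} {s : ι → E3} {σ : ι → ℤ → ℤ}

open scoped Classical in
/-- **PLATES BY SURGERY, ALL GRAINS AT ONCE.**  See the module docstring. -/
theorem exists_plates_heal (hx : IsUnitPacking x) (hσ : ∀ f, IsHaggSeq (σ f)) (cells : ι → Finset κ)
    (P Dfx : ι → κ → Finset E3) (φ : ι → κ → E3 → ℝ) (hφ : ∀ f c, ∀ p q : E3, |φ f c p - φ f c q| ≤ dist p q) (a₀ : ι → κ → ℝ)
    (t : ℝ) (ht : 0 ≤ t) {m : ℕ} (hm : 0 < m)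
    (hPS : ∀ f, ∀ c ∈ cells f, ∀ w ∈ P f c, w ∈ stacking (L f) (s f) (σ f))
    (hDv : ∀ f, ∀ c ∈ cells f, ∀ w, w ∈ stacking (L f) (s f) (σ f) → w ∉ Set.range x → (∃ p ∈ P f c, dist w p < 3) → w ∈ Dfx f c)
    (hDb : ∀ f, ∀ c ∈ cells f, ∀ b, b ∈ Set.range x → b ∉ stacking (L f) (s f) (σ f) → (∃ p ∈ P f c, dist b p < 3) → b ∈ Dfx f c)
    (hfar : ∀ f g, f ≠ g → ∀ c ∈ cells f, ∀ c' ∈ cells g, ∀ w ∈ P f c, ∀ w' ∈ P g c', 4 < dist w w') :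
    ∃ (N' : ℕ) (x' : Fin N' → E3) (k : ι → ℕ) (W : ι → Finset E3), IsUnitPacking x' ∧ (∀ f, k f < m) ∧
      (∀ f w, w ∈ W f ↔ ∃ c ∈ cells f, w ∈ P f c ∧ a₀ f c + k f * (t + 7) ≤ φ f c w ∧ φ f c w ≤ a₀ f c + k f * (t + 7) + t) ∧
      (∀ f, ∀ w ∈ W f, w ∈ Set.range x') ∧
      (∀ y, y ∈ Set.range x' ↔
        (y ∈ Set.range x ∧ ∀ f, y ∈ stacking (L f) (s f) (σ f) ∨ ∀ w ∈ W f, 1 ≤ dist y w) ∨ ∃ f, y ∈ W f) ∧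
      (m : ℝ) * (6 * (N' : ℝ) - (numContacts x' : ℝ)) ≤
        (m : ℝ) * (6 * (N : ℝ) - (numContacts x : ℝ)) + 12 * ∑ f, ∑ c ∈ cells f, ((Dfx f c).card : ℝ) ∧
      (N : ℝ) ≤ (N' : ℝ) + 27 * ∑ f, ((W f).card : ℝ) := by
  classical
  -- per grain: the common slab index, the merged window and the collar set
  have piece : ∀ f, ∃ (k : ℕ) (W B : Finset E3), k < m ∧
      (∀ w, w ∈ W ↔ ∃ c ∈ cells f, w ∈ P f c ∧ a₀ f c + k * (t + 7) ≤ φ f c w ∧ φ f c w ≤ a₀ f c + k * (t + 7) + t) ∧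
      (m : ℝ) * (B.card : ℝ) ≤ ∑ c ∈ cells f, ((Dfx f c).card : ℝ) ∧
      (∀ w, w ∈ stacking (L f) (s f) (σ f) → w ∉ W → w ∉ Set.range x → (∃ w₀ ∈ W, dist w w₀ < 3) → w ∈ B) ∧
      (∀ b, b ∈ Set.range x → b ∉ stacking (L f) (s f) (σ f) → (∀ w ∈ W, 1 ≤ dist b w) → (∃ w₀ ∈ W, dist b w₀ < 2) → b ∈ B) :=
    fun f => exists_piece_window x (stacking (L f) (s f) (σ f)) (cells f) (P f) (Dfx f) (φ f) (hφ f) (a₀ f) t ht hm (hDv f) (hDb f)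
  choose k W B hk hmemW hBle hBcol hJcol using piece
  -- blockers and vacant sites, as finsets
  set R : ι → Finset E3 := fun f => (Finset.univ.image x).filter fun a => a ∉ stacking (L f) (s f) (σ f) ∧ ∃ w ∈ W f, dist a w < 1 with hR
  set V : ι → Finset E3 := fun f => (W f).filter fun v => v ∉ Set.range x with hV
  have hWS : ∀ f, ∀ w ∈ W f, w ∈ stacking (L f) (s f) (σ f) := by
    intro f w hw
    obtain ⟨c, hc, hP, -, -⟩ := (hmemW f w).1 hw
    exact hPS f c hc w hP
  have hRdef : ∀ f a, a ∈ R f ↔ a ∈ Set.range x ∧ a ∉ stacking (L f) (s f) (σ f) ∧ ∃ w ∈ W f, dist a w < 1 := by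
    intro f a
    rw [hR, Finset.mem_filter, mem_image_univ_iff_mem_range]
  have hVdef : ∀ f v, v ∈ V f ↔ v ∈ W f ∧ v ∉ Set.range x := by
    intro f v
    rw [hV, Finset.mem_filter]
  have hfarW : ∀ f g, f ≠ g → ∀ w ∈ W f, ∀ w' ∈ W g, 4 < dist w w' := by
    intro f g hfg w hw w' hw'
    obtain ⟨c, hc, hP, -, -⟩ := (hmemW f w).1 hw
    obtain ⟨c', hc', hP', -, -⟩ := (hmemW g w').1 hw'
    exact hfar f g hfg c hc c' hc' w hP w' hP'
  obtain ⟨N', x', hx', -, hocc, hrange, hbill, hcount, hR27⟩ :=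
    exists_site_heal_family_collar hx hσ W R V B B hWS hRdef hVdef hfarW (fun f => hBcol f) (fun f => hJcol f)
  refine ⟨N', x', k, W, hx', hk, hmemW, hocc, hrange, ?_, ?_⟩
  · -- the bill: drop the (nonpositive) `−Σ hd` term and use `m·#B f ≤ Σ_c #Dfx f c`
    have hhd : 0 ≤ ∑ f, ∑ a ∈ R f, halfDefect (Finset.univ.image x) a :=
      Finset.sum_nonneg fun f _ => Finset.sum_nonneg fun a _ => halfDefect_nonneg _ (image_sep hx) a
    have hBsum : (m : ℝ) * ∑ f, (((B f).card : ℝ) + ((B f).card : ℝ)) ≤ 2 * ∑ f, ∑ c ∈ cells f, ((Dfx f c).card : ℝ) := by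
      rw [Finset.mul_sum, Finset.mul_sum]
      exact Finset.sum_le_sum fun f _ => by linarith [hBle f]
    have hm0 : (0 : ℝ) ≤ m := Nat.cast_nonneg m
    nlinarith [hbill, hhd, hBsum, hm0]
  · -- the count
    have h1 : (N : ℝ) ≤ (N' : ℝ) + ∑ f, ((R f).card : ℝ) := by exact_mod_cast hcount
    have h2 : ∑ f, ((R f).card : ℝ) ≤ ∑ f, 27 * ((W f).card : ℝ) := Finset.sum_le_sum fun f _ => hR27 f
    rw [← Finset.mul_sum] at h2
    linarith

end Summit.Ventures.Crystal3D.Theorems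

end
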